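import Summits.CriticalPhenomena.PercolationContinuityZ3.Theorems.SahiMasterFamilyTerminalAll
import Summits.CriticalPhenomena.PercolationContinuityZ3.Theorems.SahiMasterFamilyTopCoeffAll

/-!
# The rare-corner (bottom-coefficient) reduction of the identically-zero master conjecture, every order

Unit `prim-master-conj` (crux anchor stmt-CriticalPhenomena-4575), gen 8.  Gen 7's Theorem R (`SahiMasterFamilyTerminalAll`) reduces
(EQI-k) = `MasterFamilyIdentEqIff k` to the non-vanishing of TERMINAL families, at the price of three further ingredients per order
((T-a), private gluing, and — still open for `k ≥ 4` — rigidity theorems for every sharing degree plus an existence lemma).  This file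
records the simpler reduction that uses `0`-sections only:

* `nonvanishing_of_zeroCritical_all` / `masterFamilyIdentEqIff_of_zeroCritical_all`: if every **0-critical** family — `k` increasing
  events determined by `S` whose `0`-minors `secAt e false ∘ U` (`e ∈ S`) are all zero flags but which is not itself a zero flag — is
  non-vanishing (some interior `p` with `E_k(μ_p) ≠ 0`), then (T_k) holds and hence `MasterFamilyIdentEqIff k` (every order `k = n + 3`;
  induction on `|S|`: either all `0`-minors are zero flags, or some `0`-minor outside `Z_k` is non-vanishing by the induction hypothesis /
  the all-order step, and non-vanishing of a minor lifts by `exists_sahiE_ne_zero_of_sec`).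
* the BOTTOM COEFFICIENT `coeff (blockProfile S) (sahiEPoly k (ind ∘ U))` of the square-free monomial `∏_{e ∈ S} X_e` in the polynomial
  `E_k`.  For a 0-critical family determined by `S` this single integer is the leading behaviour of `E_k` at the RARE corner `p → 0`
  (`E_k(μ_t) = bottomCoeff · t^{|S|} + O(t^{|S|+1})`, paper BOTTOM-COEFFICIENT.md §2), and the census of that note (every `k`-multiset of
  non-trivial up-sets with full support on `{0,1}^n`, `(n,k) ∈ {2,3,4}×{2,3,4} ∪ {(3,5)}`, > 2.2·10⁶ 0-critical families) finds it
  in `[1, (k−1)!]` without exception — CONJECTURE (B').  `exists_interior_sahiE_ne_zero_of_sahiEPoly_ne_zero` /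
  `exists_interior_sahiE_ne_zero_of_coeff_ne_zero` (grid form of the Combinatorial Nullstellensatz, extracted from
  `SahiMasterFamilyTopCoeffAll`) turn a non-zero coefficient into non-vanishing, and
  `masterFamilyIdentEqIff_of_bottomCoeff_all` states: (B') at order `k` ⟹ `MasterFamilyIdentEqIff k`.
No conjecture is asserted (all statements take their combinatorial input as a hypothesis); axioms standard. [this work]
-/

noncomputable section

open scoped Classical

namespace Summit.CriticalPhenomena.PercolationContinuityZ3.Theorems

open Finset Function MvPolynomial
open Literature.Computability.AlgebraicComplexity (blockProfile)
open Literature.Combinatorics.Sahi2008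
open Literature.Probability.Percolation (DeterminedBy)
open Literature.Probability.Percolation.DecisionTree (ind)

variable {ι : Type} [Fintype ι]

/-! ### Non-zero polynomial ⇒ non-vanishing somewhere in the open cube -/

/-- **If the polynomial `E_k` is not zero then `E_k(μ_p) ≠ 0` for some interior `p`** (a grid point `((i+1)/(k+2))_e`; the degree
of `E_k` in each variable is `≤ k < k + 1` = the number of grid values). [this work] -/
theorem exists_interior_sahiE_ne_zero_of_sahiEPoly_ne_zero {k : ℕ} (F : Fin k → Set ι → ℝ) (hne : sahiEPoly k F ≠ 0) :
    ∃ p : ι → unitInterval, (∀ e, (p e : ℝ) ∈ Set.Ioo (0 : ℝ) 1) ∧ sahiE (bernoulliWeight p) k F ≠ 0 := by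
  have hex : ∃ x : ι → ℝ, (∀ e, x e ∈ gridPts k) ∧ eval x (sahiEPoly k F) ≠ 0 := by
    by_contra hall
    push Not at hall
    exact hne (eq_zero_of_eval_zero_at_prod_finset _ (fun _ => gridPts k)
      (fun e => (degreeOf_sahiEPoly_le e k F).trans_lt (by rw [card_gridPts]; omega)) hall)
  obtain ⟨x, hx, hxne⟩ := hex
  have hx01 : ∀ e, x e ∈ Set.Ioo (0 : ℝ) 1 := fun e => mem_Ioo_of_mem_gridPts (hx e)
  refine ⟨fun e => ⟨x e, (hx01 e).1.le, (hx01 e).2.le⟩, hx01, ?_⟩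
  rw [eval_sahiEPoly] at hxne
  exact hxne

/-! ### The bottom coefficient -/

/-- **A non-zero coefficient of the polynomial `E_k` makes the family non-vanishing in the open cube.**  Used with the exponent
`blockProfile S` of the square-free monomial `∏_{e ∈ S} X_e`: that coefficient is the BOTTOM COEFFICIENT of the family with respect to
`S` — for a family determined by `S` all of whose `0`-minors are zero flags it equals `lim_{t → 0} E_k(μ_t)/t^{|S|}`, the leading
behaviour at the rare corner. [this work] -/
theorem exists_interior_sahiE_ne_zero_of_coeff_ne_zero {k : ℕ} (U : Fin k → Set (Set ι)) (m : ι →₀ ℕ)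
    (h : coeff m (sahiEPoly k fun j => ind (U j)) ≠ 0) :
    ∃ p : ι → unitInterval, (∀ e, (p e : ℝ) ∈ Set.Ioo (0 : ℝ) 1) ∧ sahiE (bernoulliWeight p) k (fun j => ind (U j)) ≠ 0 := by
  refine exists_interior_sahiE_ne_zero_of_sahiEPoly_ne_zero _ fun h0 => h ?_
  rw [h0, coeff_zero]

/-! ### Theorem R with `0`-sections only: (T_k) from the non-vanishing of 0-critical families -/

omit [Fintype ι] in
/-- A zero flag of order `n + 3` has a zero-flag `(n+2)`-sub-family (the peeled slot). [this work] -/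
theorem exists_suppZeroFlag_succAbove_of_suppZeroFlag {n : ℕ} {U : Fin (n + 3) → Set (Set ι)}
    (h : SuppZeroFlag (n + 3) U) : ∃ m : Fin (n + 3), SuppZeroFlag (n + 2) (fun j => U (m.succAbove j)) := by
  obtain ⟨m, hm, -⟩ := h
  exact ⟨m, hm⟩

/-- **(T_k) from 0-critical families, every order `k = n + 3`.**  Suppose every 0-CRITICAL family — `k` increasing events determined by
a finite `S`, every `0`-minor `secAt e false ∘ U` (`e ∈ S`) a zero flag of order `k`, the family itself not a zero flag — has `E_k(μ_p) ≠ 0`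
for some interior `p`.  Then every family of `k` increasing events with no zero-flag `(k−1)`-sub-family is non-vanishing. [this work] -/
theorem nonvanishing_of_zeroCritical_all (n : ℕ)
    (hcrit : ∀ (ι : Type) [Fintype ι] (U : Fin (n + 3) → Set (Set ι)) (S : Finset ι), (∀ j, IsUpperSet (U j)) →
      (∀ j, DeterminedBy (U j) (↑S : Set ι)) →
      (∀ e ∈ S, SuppZeroFlag (n + 3) (fun j => secAt e false (U j))) → ¬ SuppZeroFlag (n + 3) U →
        ∃ p : ι → unitInterval, (∀ i, (p i : ℝ) ∈ Set.Ioo (0 : ℝ) 1) ∧ sahiE (bernoulliWeight p) (n + 3) (fun j => ind (U j)) ≠ 0) :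
    ∀ (ι : Type) [Fintype ι] (U : Fin (n + 3) → Set (Set ι)), (∀ j, IsUpperSet (U j)) →
      (∀ m : Fin (n + 3), ¬ SuppZeroFlag (n + 2) (fun j => U (m.succAbove j))) →
        ∃ p : ι → unitInterval, (∀ i, (p i : ℝ) ∈ Set.Ioo (0 : ℝ) 1) ∧ sahiE (bernoulliWeight p) (n + 3) (fun j => ind (U j)) ≠ 0 := by
  -- induction on the size of a determining set
  have main : ∀ (N : ℕ) (ι : Type) [Fintype ι] (U : Fin (n + 3) → Set (Set ι)) (S : Finset ι), S.card = N →
      (∀ j, IsUpperSet (U j)) → (∀ j, DeterminedBy (U j) (↑S : Set ι)) →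
      (∀ m : Fin (n + 3), ¬ SuppZeroFlag (n + 2) (fun j => U (m.succAbove j))) →
        ∃ p : ι → unitInterval, (∀ i, (p i : ℝ) ∈ Set.Ioo (0 : ℝ) 1) ∧
          sahiE (bernoulliWeight p) (n + 3) (fun j => ind (U j)) ≠ 0 := by
    intro N
    induction N with
    | zero =>
      intro ι _ U S hS hU hUS hno
      have hS0 : S = ∅ := Finset.card_eq_zero.1 hS
      refine hcrit ι U S hU hUS (fun e he => ?_) fun hZ => ?_
      · rw [hS0] at he; exact absurd he (Finset.notMem_empty e)
      · obtain ⟨m, hm⟩ := exists_suppZeroFlag_succAbove_of_suppZeroFlag hZ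
        exact hno m hm
    | succ N ih =>
      intro ι _ U S hS hU hUS hno
      -- a `0`-minor outside `Z_k` settles the family
      have minor : ∀ e ∈ S, ¬ SuppZeroFlag (n + 3) (fun j => secAt e false (U j)) →
          ∃ p : ι → unitInterval, (∀ i, (p i : ℝ) ∈ Set.Ioo (0 : ℝ) 1) ∧
            sahiE (bernoulliWeight p) (n + 3) (fun j => ind (U j)) ≠ 0 := by
        intro e heS hZ
        set V : Fin (n + 3) → Set (Set ι) := fun j => secAt e false (U j) with hV
        have hVup : ∀ j, IsUpperSet (V j) := fun j => isUpperSet_secAt e false (hU j)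
        have hVdet : ∀ j, DeterminedBy (V j) (↑(S.erase e) : Set ι) := fun j => determinedBy_secAt e false (hUS j)
        have hcard : (S.erase e).card = N := by rw [Finset.card_erase_of_mem heS, hS]; rfl
        exact exists_sahiE_ne_zero_of_sec U e false
          (exists_ne_zero_of_not_suppZeroFlag V hVup hZ fun hVno => ih ι V (S.erase e) hcard hVup hVdet hVno)
      by_cases hall : ∀ e ∈ S, SuppZeroFlag (n + 3) (fun j => secAt e false (U j))
      · refine hcrit ι U S hU hUS hall fun hZ => ?_
        obtain ⟨m, hm⟩ := exists_suppZeroFlag_succAbove_of_suppZeroFlag hZ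
        exact hno m hm
      · push Not at hall
        obtain ⟨e, heS, hZ⟩ := hall
        exact minor e heS hZ
  intro ι _ U hU hno
  have hdet : ∀ j, DeterminedBy (U j) (↑(Finset.univ : Finset ι) : Set ι) := by
    intro j
    rw [Literature.Probability.Percolation.determinedBy_iff]
    intro ω ω' h
    simp only [Finset.coe_univ, Set.inter_univ] at h
    rw [h]
  exact main _ ι U Finset.univ rfl hU hdet hno

/-- **The identically-zero master conjecture at order `k = n + 3` follows from the non-vanishing of 0-critical families.** [this work] -/
theorem masterFamilyIdentEqIff_of_zeroCritical_all (n : ℕ)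
    (hcrit : ∀ (ι : Type) [Fintype ι] (U : Fin (n + 3) → Set (Set ι)) (S : Finset ι), (∀ j, IsUpperSet (U j)) →
      (∀ j, DeterminedBy (U j) (↑S : Set ι)) →
      (∀ e ∈ S, SuppZeroFlag (n + 3) (fun j => secAt e false (U j))) → ¬ SuppZeroFlag (n + 3) U →
        ∃ p : ι → unitInterval, (∀ i, (p i : ℝ) ∈ Set.Ioo (0 : ℝ) 1) ∧ sahiE (bernoulliWeight p) (n + 3) (fun j => ind (U j)) ≠ 0) :
    MasterFamilyIdentEqIff (n + 3) :=
  (masterFamilyIdentEqIff_iff_nonvanishing n).2 (nonvanishing_of_zeroCritical_all n hcrit)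

/-- **Conjecture (B') implies (EQI-k), every order.**  If every 0-critical family of `k = n + 3` increasing events determined by `S` has a
non-zero BOTTOM coefficient — the coefficient of the square-free monomial `∏_{e∈S} X_e` (exponent `blockProfile S`) in the polynomial `E_k`,
conjecturally an integer in `[1, (k−1)!]` — then `MasterFamilyIdentEqIff k`. [this work] -/
theorem masterFamilyIdentEqIff_of_bottomCoeff_all (n : ℕ)
    (hB : ∀ (ι : Type) [Fintype ι] (U : Fin (n + 3) → Set (Set ι)) (S : Finset ι), (∀ j, IsUpperSet (U j)) →
      (∀ j, DeterminedBy (U j) (↑S : Set ι)) →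
      (∀ e ∈ S, SuppZeroFlag (n + 3) (fun j => secAt e false (U j))) → ¬ SuppZeroFlag (n + 3) U →
        coeff (blockProfile S) (sahiEPoly (n + 3) fun j => ind (U j)) ≠ 0) :
    MasterFamilyIdentEqIff (n + 3) :=
  masterFamilyIdentEqIff_of_zeroCritical_all n fun ι _ U S hU hUS h0 hZ =>
    exists_interior_sahiE_ne_zero_of_coeff_ne_zero U (blockProfile S) (hB ι U S hU hUS h0 hZ)

end Summit.CriticalPhenomena.PercolationContinuityZ3.Theorems
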